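import Summits.FinalStateConjecture.FinalStateConjecture.Theorems.EIHFluxBalanceInertialRecessionRechartWhiteHoleAlgebra
import Summits.FinalStateConjecture.FinalStateConjecture.Theorems.EIHFluxBalanceInertialRecessionAnsatzDecay
import Summits.FinalStateConjecture.FinalStateConjecture.Theorems.EIHFluxBalanceInertialRecessionLabVelocity
import Literature.Geometry.Lorentzian.KerrConvergenceProofs
import Mathlib.Analysis.SpecialFunctions.Trigonometric.Arctan

/-!
# Route EIHFluxBalance — `InertialRecession`, re-charting: kinematics of an anti-orthochronous
# hole frame (white-hole exclusion, limits)

Helper file for the crux `stmt-FinalStateConjecture-10166`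
(`Summit.FinalStateConjecture.FinalStateConjecture.Theses.EIHFluxBalance.InertialRecession`),
stub `stub_rechart` of line `sublinear-is-free-clean-window-charges`.

Small inputs of the escape construction that excludes painted WHITE holes:
* `gamma_labVelocity_eq_abs` — for `u = Λe₀`, `γ(ũ/u⁰) = |u⁰|` (no sign condition);
* `tendsto_fourVelocity_of_neg` — if `u⁰ < 0` and the lab velocity `ũ/u⁰ → V`, then
  `u(t) → (−γ(V), −γ(V)V) = −Λ_V e₀`;
* `exists_drift_le` — `ξ̇ → V` ⇒ `‖ξ(t) − ξ(t₀) − (t − t₀)V‖ ≤ ε` on windows `|t − t₀| ≤ L`, late;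
* `norm_deviation_le_of_deviationCk_le` — pointwise `C⁰` bound from the slab `Cᵏ` deviation;
* `exists_farField_bound` — `‖g_{Λⱼ(t),(t,ξⱼ(t)),Mⱼ}(x) − η‖ ≤ |Mⱼ| C/‖x̲ − ξⱼ(t)‖` on the lab slab
  `x⁰ = t` at lab distance `≥ 1` (the `m = 0` case of the ansatz decay).

[O'Neill 1983, Ch. 9; Kerr–Schild 1965, §3; folklore]
-/

noncomputable section

set_option linter.dupNamespace false

open scoped InnerProductSpace Topology
open Set Function Filter Metric Literature.Geometry.Lorentzian

namespace Summit.FinalStateConjecture.FinalStateConjecture.Theorems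

/-! ### The Lorentz factor of a frame, without sign condition -/

/-- **`γ(ũ/u⁰) = |u⁰|`** for `u = Λe₀` (from `(u⁰)² = 1 + ‖ũ‖²`). O'Neill 1983, Ch. 9, p. 233.
[folklore] -/
theorem gamma_labVelocity_eq_abs (Λ : lorentzGroup) :
    Lorentz.gamma ((((Λ : E4 ≃L[ℝ] E4) (E4.basisVector 0)) 0)⁻¹ •
      E4.spatial ((Λ : E4 ≃L[ℝ] E4) (E4.basisVector 0))) =
      |((Λ : E4 ≃L[ℝ] E4) (E4.basisVector 0)) 0| := by
  set u := (Λ : E4 ≃L[ℝ] E4) (E4.basisVector 0) with hu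
  have hsq := lorentz_apply_zero_sq Λ
  rw [← hu] at hsq
  have h0 : u 0 ≠ 0 := fun h ↦ by
    rw [h] at hsq; nlinarith [E4.spatialNorm_nonneg u]
  have habs : 0 < |u 0| := abs_pos.mpr h0
  have hnorm : ‖(u 0)⁻¹ • E4.spatial u‖ ^ 2 = 1 - (u 0 ^ 2)⁻¹ := by
    rw [norm_smul, mul_pow, norm_inv, Real.norm_eq_abs, inv_pow, sq_abs]
    have : ‖E4.spatial u‖ = E4.spatialNorm u := rfl
    rw [this]
    field_simp
    linarith
  unfold Lorentz.gamma
  rw [hnorm, show (1 : ℝ) - (1 - (u 0 ^ 2)⁻¹) = (|u 0|⁻¹) ^ 2 by rw [inv_pow, sq_abs]; ring,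
    Real.sqrt_sq (inv_nonneg.mpr habs.le), inv_inv]

/-- The Lorentz factor is continuous on the open unit ball. [folklore] -/
theorem continuousAt_gamma {V : E3} (hV : ‖V‖ < 1) : ContinuousAt Lorentz.gamma V := by
  unfold Lorentz.gamma
  refine ContinuousAt.inv₀ ?_ (ne_of_gt (Real.sqrt_pos.2 (Lorentz.one_sub_norm_sq_pos hV)))
  exact ((continuous_const.sub (continuous_norm.pow 2)).sqrt).continuousAt

/-- `a ↦ (f a, g a)` is continuous for continuous `f`, `g` (bookkeeping). [folklore] -/
theorem continuous_ofTimeSpace_comp {α : Type*} [TopologicalSpace α] {f : α → ℝ} {g : α → E3}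
    (hf : Continuous f) (hg : Continuous g) : Continuous fun a ↦ E4.ofTimeSpace (f a) (g a) := by
  have : (fun a ↦ E4.ofTimeSpace (f a) (g a)) = fun a ↦ f a • E4.basisVector 0 + E4.ofTimeSpace 0 (g a) :=
    funext fun a ↦ E4.ofTimeSpace_eq_smul_add _ _
  rw [this]
  exact (hf.smul continuous_const).add ((E4.continuous_ofTimeSpace 0).comp hg)

/-- `−Λ_V e₀ = (−γ, −γV)`. [folklore] -/
theorem neg_boostCLM_basisVector_zero {V : E3} (hV : ‖V‖ < 1) :
    -Lorentz.boostCLM V (E4.basisVector 0) =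
      E4.ofTimeSpace (-Lorentz.gamma V) ((-Lorentz.gamma V) • V) := by
  have h := Lorentz.boost_apply_basisVector_zero hV
  rw [Lorentz.coe_boost_apply] at h
  rw [h, E4.ofTimeSpace_eq_smul_add, E4.ofTimeSpace_eq_smul_add (-Lorentz.gamma V), neg_smul,
    neg_smul, ← E4.spaceEmbed_apply, ← E4.spaceEmbed_apply, map_neg, neg_add]

/-- **The 4-velocity of an anti-orthochronous frame with convergent lab velocity converges**:
if `u⁰(t) < 0` and `ũ/u⁰ → V` (`‖V‖ < 1`), then `u(t) → (−γ(V), −γ(V)V) = −Λ_V e₀`. [folklore] -/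
theorem tendsto_fourVelocity_of_neg (Λ : ℝ → lorentzGroup)
    (hneg : ∀ t, ((Λ t : E4 ≃L[ℝ] E4) (E4.basisVector 0)) 0 < 0) {V : E3} (hV : ‖V‖ < 1)
    (hv : Tendsto (fun t ↦ (((Λ t : E4 ≃L[ℝ] E4) (E4.basisVector 0)) 0)⁻¹ •
      E4.spatial ((Λ t : E4 ≃L[ℝ] E4) (E4.basisVector 0))) atTop (𝓝 V)) :
    Tendsto (fun t ↦ ((Λ t : E4 ≃L[ℝ] E4) (E4.basisVector 0) : E4)) atTop
      (𝓝 (-Lorentz.boostCLM V (E4.basisVector 0))) := by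
  set F : E3 → E4 := fun v ↦ E4.ofTimeSpace (-Lorentz.gamma v) ((-Lorentz.gamma v) • v) with hF
  have hFc : ContinuousAt F V := by
    have hγ := continuousAt_gamma hV
    have h1 : ContinuousAt (fun v ↦ (-Lorentz.gamma v, (-Lorentz.gamma v) • v)) V :=
      hγ.neg.prodMk (hγ.neg.smul continuousAt_id)
    exact (continuous_ofTimeSpace_comp continuous_fst continuous_snd).continuousAt.comp h1
  have hfun : ∀ t, (Λ t : E4 ≃L[ℝ] E4) (E4.basisVector 0) =
      F ((((Λ t : E4 ≃L[ℝ] E4) (E4.basisVector 0)) 0)⁻¹ •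
        E4.spatial ((Λ t : E4 ≃L[ℝ] E4) (E4.basisVector 0))) := by
    intro t
    set u := (Λ t : E4 ≃L[ℝ] E4) (E4.basisVector 0) with hu
    have hγu : Lorentz.gamma ((u 0)⁻¹ • E4.spatial u) = -(u 0) := by
      rw [hu, gamma_labVelocity_eq_abs, abs_of_neg (hneg t)]
    simp only [hF, hγu, neg_neg]
    rw [smul_smul, mul_inv_cancel₀ (hneg t).ne, one_smul]
    exact (E4.ofTimeSpace_time_spatial u).symm
  have hcomp : (fun t ↦ ((Λ t : E4 ≃L[ℝ] E4) (E4.basisVector 0) : E4)) =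
      F ∘ fun t ↦ (((Λ t : E4 ≃L[ℝ] E4) (E4.basisVector 0)) 0)⁻¹ •
        E4.spatial ((Λ t : E4 ≃L[ℝ] E4) (E4.basisVector 0)) := funext hfun
  rw [neg_boostCLM_basisVector_zero hV, hcomp]
  exact hFc.tendsto.comp hv

/-! ### Drift of the centre over late windows -/

/-- **Drift control**: if `ξ` is differentiable with `ξ̇ → V`, then for `L, ε > 0` and all late
`t₀`, `‖ξ(t) − ξ(t₀) − (t − t₀)V‖ ≤ ε` whenever `|t − t₀| ≤ L` (mean value inequality for
`ξ − tV` on `[t₀ − L, ∞)`). [folklore] -/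
theorem exists_drift_le {ξ : ℝ → E3} (hξ : Differentiable ℝ ξ) {V : E3}
    (h : Tendsto (deriv ξ) atTop (𝓝 V)) {L ε : ℝ} (hL : 0 < L) (hε : 0 < ε) :
    ∃ T : ℝ, ∀ t₀ t : ℝ, T + L ≤ t₀ → |t - t₀| ≤ L → ‖ξ t - ξ t₀ - (t - t₀) • V‖ ≤ ε := by
  set g : ℝ → E3 := fun t ↦ ξ t - t • V with hg
  have hgd : ∀ t, HasDerivAt g (deriv ξ t - V) t := fun t ↦
    (hξ t).hasDerivAt.sub ((hasDerivAt_id t).smul_const V |>.congr_deriv (by simp))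
  have hg' : Tendsto (fun t ↦ deriv ξ t - V) atTop (𝓝 0) := by simpa using h.sub_const V
  have hεL : 0 < ε / L := by positivity
  obtain ⟨T, hT⟩ := (Metric.tendsto_atTop.mp hg') (ε / L) hεL
  refine ⟨T, fun t₀ t ht₀ ht ↦ ?_⟩
  have hconv : Convex ℝ (Ici T) := convex_Ici T
  have hbound : ∀ s ∈ Ici T, ‖deriv g s‖ ≤ ε / L := fun s hs ↦ by
    rw [(hgd s).deriv]
    have := hT s hs
    rw [dist_zero_right] at this
    exact this.le
  have ht₀T : t₀ ∈ Ici T := by show T ≤ t₀; linarith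
  have htT : t ∈ Ici T := by
    show T ≤ t
    have := (abs_le.mp ht).1; linarith
  have hmv := hconv.norm_image_sub_le_of_norm_deriv_le (fun s _ ↦ (hgd s).differentiableAt)
    hbound ht₀T htT
  have heq : g t - g t₀ = ξ t - ξ t₀ - (t - t₀) • V := by
    simp only [hg, sub_smul]; abel
  rw [heq] at hmv
  calc ‖ξ t - ξ t₀ - (t - t₀) • V‖ ≤ ε / L * ‖t - t₀‖ := hmv
    _ ≤ ε / L * L := by
        refine mul_le_mul_of_nonneg_left ?_ hεL.le
        rw [Real.norm_eq_abs]; exact ht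
    _ = ε := by field_simp

/-- Registered one-line form (stub `drift_le_rechart` of the crux item) of `exists_drift_le`.
[folklore] -/
theorem drift_le_rechart : open Filter Topology in ∀ {ξ : ℝ → E3}, Differentiable ℝ ξ → ∀ {V : E3}, Tendsto (deriv ξ) atTop (𝓝 V) → ∀ {L ε : ℝ}, 0 < L → 0 < ε → ∃ T : ℝ, ∀ t₀ t : ℝ, T + L ≤ t₀ → |t - t₀| ≤ L → ‖ξ t - ξ t₀ - (t - t₀) • V‖ ≤ ε :=
  fun hξ _ h _ _ hL hε ↦ exists_drift_le hξ h hL hε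

/-! ### Pointwise deviation bound from the slab norm -/

/-- **Pointwise `C⁰` bound from the slab `Cᵏ` deviation**: if the `Cᵏ` deviation on the slab
`{t = t(x)}` is `≤ c`, then `‖(Φ^*g − g₀)(x)‖ ≤ c`. DHRT arXiv:2104.08222, §1 (bookkeeping).
[folklore] -/
theorem norm_deviation_le_of_deviationCk_le (𝓢 : Spacetime 4) (B : ModelBackground)
    (Φ : B.domain → 𝓢.carrier) (k : ℕ) {c : ℝ} (hc : 0 ≤ c) (x : B.domain)
    (h : 𝓢.deviationCk B Φ k (B.time x.1) ≤ ENNReal.ofReal c) :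
    ‖𝓢.deviation B Φ x‖ ≤ c := by
  have hmem : x.1 ∈ Subtype.val '' B.timeSlab (B.time x.1) :=
    mem_image_of_mem _ (show x ∈ B.timeSlab (B.time x.1) from rfl)
  have h1 := enorm_iteratedFDeriv_le_supCkENorm (Nat.zero_le k) hmem (𝓢.deviationExtend B Φ)
  have h2 : ‖iteratedFDeriv ℝ 0 (𝓢.deviationExtend B Φ) x.1‖ₑ ≤ ENNReal.ofReal c := h1.trans h
  rw [← ofReal_norm, norm_iteratedFDeriv_zero, Spacetime.deviationExtend_coe,
    ENNReal.ofReal_le_ofReal_iff hc] at h2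
  exact h2

/-! ### The far field of one painted hole -/

/-- **Far-field bound of one painted Schwarzschild hole, `C⁰`**: for continuous centre and frame
(the inverse frame bounded by `Γ` in operator norm), on the lab slab `x⁰ = t` at lab distance
`≥ 1` from the centre, `‖g_{Λ(t),(t,ξ(t)),M}(x) − η‖ ≤ |M| C/‖x̲ − ξ(t)‖` — the `m = 0` case of
`exists_norm_iteratedFDeriv_ansatzSummand_le'`. Kerr–Schild 1965, §3. [folklore] -/
theorem exists_farField_bound {Γ : ℝ} (hΓ : 1 ≤ Γ) :
    ∃ C : ℝ, 0 ≤ C ∧ ∀ (M : ℝ) (Λ : ℝ → lorentzGroup) (ξ : ℝ → E3) (t : ℝ) (x : E4),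
      Continuous (fun s ↦ (((Λ s : E4 ≃L[ℝ] E4).symm : E4 →L[ℝ] E4))) → Continuous ξ →
      (∀ s, ‖(((Λ s : E4 ≃L[ℝ] E4).symm : E4 →L[ℝ] E4))‖ ≤ Γ) →
      x 0 = t → 1 ≤ ‖E4.spatial x - ξ t‖ →
      ‖boostedKerrBilin (Λ t) (E4.ofTimeSpace t (ξ t)) M 0 x - Minkowski.bilin‖ ≤
        |M| * C / ‖E4.spatial x - ξ t‖ := by
  obtain ⟨C, hC0, hC⟩ := exists_norm_iteratedFDeriv_ansatzSummand_le' 0 hΓ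
  refine ⟨C, hC0, fun M Λ ξ t x hΛ hξ hΛb hx hd ↦ ?_⟩
  have h := hC M 0 Λ ξ t x (contDiff_zero.mpr hΛ) (contDiff_zero.mpr hξ)
    (fun k hk ↦ by
      have hk0 : k = 0 := Nat.le_zero.mp hk
      subst hk0
      rw [iteratedDeriv_zero]; exact hΛb t)
    (fun k hk1 hk0 ↦ by omega) hx (by rwa [abs_zero, mul_zero, max_eq_left zero_le_one])
  rwa [norm_iteratedFDeriv_zero, hx] at h

/-! ### Linear bookkeeping for `ofTimeSpace` -/

/-- `ofTimeSpace` is linear: `(a, p) + c•(b, q) = (a + cb, p + cq)`. [folklore] -/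
theorem ofTimeSpace_add_smul (a b c : ℝ) (p q : E3) :
    E4.ofTimeSpace a p + c • E4.ofTimeSpace b q = E4.ofTimeSpace (a + c * b) (p + c • q) := by
  rw [E4.ofTimeSpace_eq_smul_add a, E4.ofTimeSpace_eq_smul_add b,
    E4.ofTimeSpace_eq_smul_add (a + c * b), ← E4.spaceEmbed_apply, ← E4.spaceEmbed_apply,
    ← E4.spaceEmbed_apply, map_add, map_smul, smul_add, smul_smul, add_smul]
  abel

/-- `ofTimeSpace` is linear: `(a, p) − c•(b, q) = (a − cb, p − cq)`. [folklore] -/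
theorem ofTimeSpace_sub_smul (a b c : ℝ) (p q : E3) :
    E4.ofTimeSpace a p - c • E4.ofTimeSpace b q = E4.ofTimeSpace (a - c * b) (p - c • q) := by
  have h := ofTimeSpace_add_smul a b (-c) p q
  rw [neg_smul, ← sub_eq_add_neg, neg_mul, ← sub_eq_add_neg, neg_smul, ← sub_eq_add_neg] at h
  exact h

/-! ### Small inputs of the escape construction -/

/-- The inverse frames of a continuous frame are continuous (inversion is continuous at invertible
operators, `contDiffAt_map_inverse`). [folklore] -/
theorem continuous_lorentz_symm_of_continuous {Λ : ℝ → lorentzGroup}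
    (hΛ : Continuous fun t ↦ ((Λ t : E4 ≃L[ℝ] E4) : E4 →L[ℝ] E4)) :
    Continuous fun t : ℝ ↦ (((Λ t : E4 ≃L[ℝ] E4).symm : E4 ≃L[ℝ] E4) : E4 →L[ℝ] E4) := by
  have he : (fun t : ℝ ↦ (((Λ t : E4 ≃L[ℝ] E4).symm : E4 ≃L[ℝ] E4) : E4 →L[ℝ] E4)) =
      ContinuousLinearMap.inverse ∘ fun t ↦ ((Λ t : E4 ≃L[ℝ] E4) : E4 →L[ℝ] E4) := by
    funext t
    simp only [comp_apply, ContinuousLinearMap.inverse_equiv]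
  rw [he]
  exact continuous_iff_continuousAt.2 fun t ↦
    ContinuousAt.comp (f := fun s : ℝ ↦ ((Λ s : E4 ≃L[ℝ] E4) : E4 →L[ℝ] E4)) (x := t)
      (contDiffAt_map_inverse (n := 0) (Λ t : E4 ≃L[ℝ] E4)).continuousAt hΛ.continuousAt

/-- The scaled arctangent `s = (16θ/π) arctan σ` has `|s| ≤ 8θ`, so `s + 8θ ∈ [0, 16θ]`. [folklore] -/
theorem arctan_scale_bounds {θ : ℝ} (hθ : 0 < θ) (σ : ℝ) :
    16 * θ / Real.pi * Real.arctan σ + 8 * θ ∈ Icc 0 (16 * θ) ∧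
      |16 * θ / Real.pi * Real.arctan σ| ≤ 8 * θ := by
  have h1 := Real.arctan_lt_pi_div_two σ
  have h2 := Real.neg_pi_div_two_lt_arctan σ
  have hπ := Real.pi_pos
  have hc₁0 : 0 < 16 * θ / Real.pi := by positivity
  have hc : 16 * θ / Real.pi * (Real.pi / 2) = 8 * θ := by field_simp; ring
  have h3 : 16 * θ / Real.pi * Real.arctan σ < 8 * θ := by
    rw [← hc]; exact mul_lt_mul_of_pos_left h1 hc₁0
  have h4 : -(8 * θ) < 16 * θ / Real.pi * Real.arctan σ := by
    rw [← hc, show -(16 * θ / Real.pi * (Real.pi / 2)) = 16 * θ / Real.pi * (-(Real.pi / 2)) by ring]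
    exact mul_lt_mul_of_pos_left h2 hc₁0
  exact ⟨⟨by linarith, by linarith⟩, abs_le.mpr ⟨h4.le, h3.le⟩⟩

/-- **Lab distance `≤` painted radius** on the lab slab through the centre:
`‖x̲ − ξ‖ ≤ r₀(Λ⁻¹(x − (t, ξ)))` (boosts only stretch spatial separations). [folklore] -/
theorem norm_spatial_sub_le_radius_poincareInv (Λ : lorentzGroup) (t : ℝ) (ξ : E3) {x : E4}
    (hx : x 0 = t) : ‖E4.spatial x - ξ‖ ≤ Kerr.radius 0 (poincareInv Λ (E4.ofTimeSpace t ξ) x) := by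
  have h := sq_sub_sq_le_radius_poincareInv_sq Λ 0 t ξ hx
  rw [zero_pow two_ne_zero, sub_zero] at h
  exact (pow_le_pow_iff_left₀ (norm_nonneg _) (Kerr.radius_nonneg _ _) two_ne_zero).mp h

/-- `|B(W, W)| ≤ ‖B‖‖W‖²` for a bilinear form `B`. [folklore] -/
theorem abs_apply_self_le_opNorm (B : E4 →L[ℝ] E4 →L[ℝ] ℝ) (W : E4) : |B W W| ≤ ‖B‖ * ‖W‖ * ‖W‖ := by
  rw [← Real.norm_eq_abs]
  exact ContinuousLinearMap.le_opNorm₂ _ _ _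

/-- `(1, V) = Λ_V(γ⁻¹, 0)`. [folklore] -/
theorem ofTimeSpace_one_eq_boostCLM {V : E3} (hV : ‖V‖ < 1) :
    E4.ofTimeSpace 1 V = Lorentz.boostCLM V (E4.ofTimeSpace (Lorentz.gamma V)⁻¹ 0) := by
  have hγV := Lorentz.gamma_pos hV
  rw [← E4.ofTimeSpace_time_spatial (Lorentz.boostCLM V (E4.ofTimeSpace (Lorentz.gamma V)⁻¹ 0)),
    E4.time_apply, Lorentz.boostCLM_apply_zero, Lorentz.spatial_boostCLM_apply,
    E4.ofTimeSpace_apply_zero, E4.spatial_ofTimeSpace]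
  simp [mul_inv_cancel₀ hγV.ne']

/-- **The frozen decomposition of the escape segment**: with `b₀ = Λ_V(0, r_c n̂)`,
`W₀ = Λ_V(1, ½n̂)`, for every `s` and lab-time lapse `Δ = b₀⁰ + sW₀⁰`,
`b₀ + sW₀ − Δ(1, V) = Λ_V(s − Δ/γ, (r_c + s/2)n̂)` (linearity and `(1, V) = Λ_V(γ⁻¹, 0)`). [folklore] -/
theorem frozen_decomposition {V : E3} (hV : ‖V‖ < 1) (n : E3) (rc s Δ : ℝ) :
    Lorentz.boostCLM V (E4.ofTimeSpace 0 (rc • n)) +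
        s • Lorentz.boostCLM V (E4.ofTimeSpace 1 ((1 / 2 : ℝ) • n)) - Δ • E4.ofTimeSpace 1 V =
      Lorentz.boostCLM V (E4.ofTimeSpace (s - Δ * (Lorentz.gamma V)⁻¹) ((rc + s / 2) • n)) := by
  rw [ofTimeSpace_one_eq_boostCLM hV, ← map_smul, ← map_smul, ← map_add, ← map_sub]
  congr 1
  rw [ofTimeSpace_add_smul, ofTimeSpace_sub_smul]
  congr 1
  · ring
  · rw [smul_zero, sub_zero, smul_smul, ← add_smul]
    congr 1
    ring

/-- A sum over all indices but one of terms bounded by `1/(10(N+1))` in absolute value is `≤ 1/10`.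
[folklore] -/
theorem sum_erase_le_tenth {N : ℕ} (i : Fin N) (f : Fin N → ℝ)
    (h : ∀ j, j ≠ i → |f j| ≤ 1 / (10 * (N + 1))) : ∑ j ∈ Finset.univ.erase i, f j ≤ 1 / 10 := by
  have h1 : ∑ j ∈ Finset.univ.erase i, f j ≤ ∑ j ∈ Finset.univ.erase i, (1 / (10 * (N + 1)) : ℝ) :=
    Finset.sum_le_sum fun j hj ↦ (le_abs_self _).trans (h j (Finset.ne_of_mem_erase hj))
  have h2 : ∑ j ∈ Finset.univ.erase i, (1 / (10 * (N + 1)) : ℝ) ≤ N * (1 / (10 * (N + 1))) := by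
    rw [Finset.sum_const, nsmul_eq_mul]
    refine mul_le_mul_of_nonneg_right ?_ (by positivity)
    have : (Finset.univ.erase i).card ≤ N := (Finset.card_le_univ _).trans (by simp)
    exact_mod_cast this
  have h3 : (N : ℝ) * (1 / (10 * (N + 1))) ≤ 1 / 10 := by
    rw [mul_one_div, div_le_div_iff₀ (by positivity) (by norm_num)]
    nlinarith
  linarith

/-- The escape direction raises lab time: `(Λ_V(1, ½n̂))⁰ = γ(1 + ½⟪V, n̂⟫) > 0` (`‖n̂‖ = 1`). [folklore] -/
theorem boostCLM_escape_apply_zero_pos {V : E3} (hV : ‖V‖ < 1) {n : E3} (hn : ‖n‖ = 1) :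
    0 < (Lorentz.boostCLM V (E4.ofTimeSpace 1 ((1 / 2 : ℝ) • n))) 0 := by
  rw [Lorentz.boostCLM_apply_zero, E4.ofTimeSpace_apply_zero, E4.spatial_ofTimeSpace, inner_smul_right]
  have h1 : |inner ℝ V n| ≤ ‖V‖ * ‖n‖ := abs_real_inner_le_norm V n
  rw [hn, mul_one] at h1
  have h2 := (abs_le.mp h1).1
  exact mul_pos (Lorentz.gamma_pos hV) (by linarith)

/-- The frozen ray `s ↦ Λ_V(ζ(s), (r₀ + s/2)n̂)` is continuous for continuous `ζ`. [folklore] -/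
theorem continuous_frozenRay (V n : E3) (r₀ : ℝ) {ζ : ℝ → ℝ} (hζ : Continuous ζ) :
    Continuous fun s : ℝ ↦ Lorentz.boostCLM V (E4.ofTimeSpace (ζ s) ((r₀ + s / 2) • n)) := by
  refine (Lorentz.boostCLM V).continuous.comp ?_
  have h1 : Continuous fun s : ℝ ↦ (r₀ + s / 2) • n := by fun_prop
  exact continuous_ofTimeSpace_comp hζ h1

end Summit.FinalStateConjecture.FinalStateConjecture.Theorems
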